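import Summits.AtomisticToContinuum.HydrodynamicLimit.Theorems.TwoClocksEquilibriumFastWindowLDNormalFormEquivalence
import HarnessLib

/-!
# Automatic uniformity of the tilt range of `TwoClocks.EquilibriumFastWindowLD`, without compact support, eventual in the window

Crux `Summit.AtomisticToContinuum.HydrodynamicLimit.Theses.AntiMazurCoboundaries.KineticWindowGronwall`
(stmt-AtomisticToContinuum-9282, `= KineticFluxLdDecay → RelEntropyVanishing`; shared verbatim with route FluxGibbsianityLdDrude),
line `rare-band-ladder-dock`, helper file 1 of 2 of lead c4 toward DOCKING THE RARE BAND ON THE BOARD (file 2: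
`…KineticWindowGronwallRareBandDock`: `TwoClocks.EquilibriumFastWindowLD → QuadraticClassLdDecay → RareBandLdDecay ∧ KineticFluxLdDecay`).

`uniformWindowLD_of_equilibriumFastWindowLD`: the TwoClocks crux `EquilibriumFastWindowLD` (stmt-14440: window LD at global
equilibrium for every continuous fast one-body `F(x,v)` of quadratic growth, tilt range `β₀(F)` AFTER the observable) already carries
a tilt range UNIFORM over the weighted sup-norm balls `|F(x,v)| ≤ C'(1+|v|²)` and the bound EVENTUALLY in the window
(`∃ τ₀ ∀ τ ≥ τ₀`). This is VERBATIM the Baire-category argument of the landed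
`FastWindowRG.boundedWindowLD_of_EquilibriumFastWindowLD` (14440 line `Sketch`: cover `exists_windowGood_of_fastWindowLD`, closure
`windowGood_of_approx`, sum `windowGood_add`, symmetry `windowGood_neg`, scaling `windowGood_const_mul`,
`exists_uniform_range_of_baire` on the closed subspace `isClosed_fastClass` of `𝕋³ × ℝ³ →ᵇ ℝ`), which proves exactly this internally
and then re-weakens to `∃ τ` and adds a compact-`v`-support binder it never uses; both are undone here. No dynamics.

References: W. Rudin, *Functional Analysis* (1991) Thm 2.5 (uniform boundedness via Baire).
-/

noncomputable section

open MeasureTheory ProbabilityTheory Real Set Filter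
open scoped ENNReal BigOperators BoundedContinuousFunction

namespace Summit.AtomisticToContinuum.HydrodynamicLimit.Theorems.KineticWindowGronwallRareBandDock

open Literature.Analysis.FluidPDE Literature.MathematicalPhysics.KineticTheory
open Summit.AtomisticToContinuum.HydrodynamicLimit.Theorems.FastWindowRG
open Summit.AtomisticToContinuum.HydrodynamicLimit.Theses.TwoClocks (EquilibriumFastWindowLD)

/-! ## §1 Automatic uniformity of the tilt range (Baire), without compact support, eventual in the window -/

/-- **Registered helper stub signature `stub_uniformWindowLD`** (helper of `stub_rareBand`, line `rare-band-ladder-dock`): the TwoClocks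
crux `EquilibriumFastWindowLD` with a tilt range UNIFORM over the weighted sup-norm balls `|G(x,v)| ≤ C'(1+|v|²)` (no compact-support
clause) and the window bound EVENTUAL in the window (`∃ τ₀ ∀ τ ≥ τ₀`). -/
def UniformWindowLDOfEquilibriumFastWindowLD : Prop :=
  EquilibriumFastWindowLD →
    ∃ σ₀ : ℝ, 0 < σ₀ ∧ ∀ (a₀ θ₀ : ℝ) (u₀ : V3), 0 < a₀ → 0 < θ₀ → ∀ σ : ℝ, 0 < σ → σ < σ₀ →
      ∀ Φ : (N : ℕ) → HardSphereFlow (Torus.geometry (Fin 3)) (hsDiameter σ N) (N + 1),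
      ∀ C' : ℝ, 0 ≤ C' → ∃ β₁ : ℝ, 0 < β₁ ∧
      ∀ G : T3 × V3 → ℝ, Continuous G → (∀ y, |G y| ≤ C' * (1 + ‖y.2‖ ^ 2)) →
      (∀ x, ∫ v, G (x, v) * localMaxwellian 1 θ₀ u₀ v = 0) →
      (∀ x (j : Fin 3), ∫ v, G (x, v) * v j * localMaxwellian 1 θ₀ u₀ v = 0) →
      (∀ x, ∫ v, G (x, v) * ‖v‖ ^ 2 * localMaxwellian 1 θ₀ u₀ v = 0) →
      ∀ β : ℝ, |β| ≤ β₁ → ∀ ε : ℝ, 0 < ε → ∃ τ₀ : ℝ, 0 < τ₀ ∧ ∀ τ : ℝ, τ₀ ≤ τ → ∃ N₀ : ℕ, ∀ N : ℕ, N₀ ≤ N →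
        ∫⁻ z, ENNReal.ofReal (Real.exp (β * ∑ i : Fin (N + 1),
            (τ * ((N : ℝ) + 1) ^ (-(1 / 3 : ℝ)))⁻¹ *
              ∫ r in (0 : ℝ)..(τ * ((N : ℝ) + 1) ^ (-(1 / 3 : ℝ))), G (((Φ N).flow r z) i)))
          ∂(localGibbsLaw σ (fun _ => a₀) (fun _ => u₀) (fun _ => θ₀) N (Φ N)) ≤
          ENNReal.ofReal (Real.exp (ε * ((N : ℝ) + 1)))


/-- **`EquilibriumFastWindowLD` with a CLASS-UNIFORM tilt range, eventual in the window.** For `σ < σ₀' := min σ₀ ½`, every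
flow family `Φ` and every growth constant `C' ≥ 0` there is ONE tilt range `β₁ > 0` serving every continuous `G` with
`|G(x,v)| ≤ C'(1+|v|²)` orthogonal at every `x` under `M_{1,u₀,θ₀}` to `1, v_j, |v|²`, and the window bound then holds for ALL
windows beyond a threshold: `∀ |β| ≤ β₁ ∀ ε ∃ τ₀ ∀ τ ≥ τ₀ ∃ N₀ ∀ N ≥ N₀, M^G_N(β, τ) ≤ e^{ε(N+1)}`. Proof: VERBATIM the Baire
argument of `FastWindowRG.boundedWindowLD_of_EquilibriumFastWindowLD` (cover `exists_windowGood_of_fastWindowLD`, closure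
`windowGood_of_approx`, sum `windowGood_add`, symmetry `windowGood_neg`, scaling `windowGood_const_mul`,
`exists_uniform_range_of_baire` on `isClosed_fastClass`), keeping the eventual form it proves internally and dropping the unused
compact-support binder. [cite: Rudin1991, Thm 2.5] -/
theorem uniformWindowLD_of_equilibriumFastWindowLD :
    EquilibriumFastWindowLD →
    ∃ σ₀ : ℝ, 0 < σ₀ ∧ ∀ (a₀ θ₀ : ℝ) (u₀ : V3), 0 < a₀ → 0 < θ₀ → ∀ σ : ℝ, 0 < σ → σ < σ₀ →
      ∀ Φ : (N : ℕ) → HardSphereFlow (Torus.geometry (Fin 3)) (hsDiameter σ N) (N + 1),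
      ∀ C' : ℝ, 0 ≤ C' → ∃ β₁ : ℝ, 0 < β₁ ∧
      ∀ G : T3 × V3 → ℝ, Continuous G → (∀ y, |G y| ≤ C' * (1 + ‖y.2‖ ^ 2)) →
      (∀ x, ∫ v, G (x, v) * localMaxwellian 1 θ₀ u₀ v = 0) →
      (∀ x (j : Fin 3), ∫ v, G (x, v) * v j * localMaxwellian 1 θ₀ u₀ v = 0) →
      (∀ x, ∫ v, G (x, v) * ‖v‖ ^ 2 * localMaxwellian 1 θ₀ u₀ v = 0) →
      ∀ β : ℝ, |β| ≤ β₁ → ∀ ε : ℝ, 0 < ε → ∃ τ₀ : ℝ, 0 < τ₀ ∧ ∀ τ : ℝ, τ₀ ≤ τ → ∃ N₀ : ℕ, ∀ N : ℕ, N₀ ≤ N →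
        ∫⁻ z, ENNReal.ofReal (Real.exp (β * ∑ i : Fin (N + 1),
            (τ * ((N : ℝ) + 1) ^ (-(1 / 3 : ℝ)))⁻¹ *
              ∫ r in (0 : ℝ)..(τ * ((N : ℝ) + 1) ^ (-(1 / 3 : ℝ))), G (((Φ N).flow r z) i)))
          ∂(localGibbsLaw σ (fun _ => a₀) (fun _ => u₀) (fun _ => θ₀) N (Φ N)) ≤
          ENNReal.ofReal (Real.exp (ε * ((N : ℝ) + 1))) := by
  rintro ⟨σ₀, hσ₀, hE⟩
  refine ⟨min σ₀ (1 / 2), lt_min hσ₀ (by norm_num), ?_⟩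
  intro a₀ θ₀ u₀ ha hθ σ hσ hσlt Φ C' hC'
  have hσ₀' : σ < σ₀ := hσlt.trans_le (min_le_left _ _)
  have hσ2 : σ ≤ 1 / 2 := (hσlt.trans_le (min_le_right _ _)).le
  have hEσ := hE a₀ θ₀ u₀ ha hθ σ hσ hσ₀' Φ
  -- the six hypotheses of the Baire lemma for the eventual window bound of `f ω`
  have hcover : ∀ f ∈ {f : T3 × V3 →ᵇ ℝ |
      (∀ x, ∫ v, f (x, v) * (1 + ‖v‖ ^ 2) * localMaxwellian 1 θ₀ u₀ v = 0) ∧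
      (∀ x (j : Fin 3), ∫ v, f (x, v) * (1 + ‖v‖ ^ 2) * v j * localMaxwellian 1 θ₀ u₀ v = 0) ∧
      (∀ x, ∫ v, f (x, v) * (1 + ‖v‖ ^ 2) * ‖v‖ ^ 2 * localMaxwellian 1 θ₀ u₀ v = 0)},
      ∃ b : ℝ, 0 < b ∧
      ∀ β : ℝ, |β| ≤ b → ∀ ε : ℝ, 0 < ε → ∃ τ₀ : ℝ, 0 < τ₀ ∧ ∀ τ : ℝ, τ₀ ≤ τ →
        ∃ N₀ : ℕ, ∀ N : ℕ, N₀ ≤ N →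
          ∫⁻ z, ENNReal.ofReal (Real.exp (β * ∑ i : Fin (N + 1),
              (τ * ((N : ℝ) + 1) ^ (-(1 / 3 : ℝ)))⁻¹ *
                ∫ r in (0 : ℝ)..(τ * ((N : ℝ) + 1) ^ (-(1 / 3 : ℝ))), f (((Φ N).flow r z) i) * (1 + ‖(((Φ N).flow r z) i).2‖ ^ 2)))
            ∂(localGibbsLaw σ (fun _ => a₀) (fun _ => u₀) (fun _ => θ₀) N (Φ N)) ≤
            ENNReal.ofReal (Real.exp (ε * ((N : ℝ) + 1))) :=
    fun f hf => by
      obtain ⟨h0, h1, h2⟩ := hf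
      exact exists_windowGood_of_fastWindowLD ha hθ u₀ hσ2 Φ hEσ f h0 h1 h2
  have hanti : ∀ (b b' : ℝ) (f : T3 × V3 →ᵇ ℝ),
      (∀ β : ℝ, |β| ≤ b → ∀ ε : ℝ, 0 < ε → ∃ τ₀ : ℝ, 0 < τ₀ ∧ ∀ τ : ℝ, τ₀ ≤ τ →
        ∃ N₀ : ℕ, ∀ N : ℕ, N₀ ≤ N →
          ∫⁻ z, ENNReal.ofReal (Real.exp (β * ∑ i : Fin (N + 1),
              (τ * ((N : ℝ) + 1) ^ (-(1 / 3 : ℝ)))⁻¹ *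
                ∫ r in (0 : ℝ)..(τ * ((N : ℝ) + 1) ^ (-(1 / 3 : ℝ))), f (((Φ N).flow r z) i) * (1 + ‖(((Φ N).flow r z) i).2‖ ^ 2)))
            ∂(localGibbsLaw σ (fun _ => a₀) (fun _ => u₀) (fun _ => θ₀) N (Φ N)) ≤
            ENNReal.ofReal (Real.exp (ε * ((N : ℝ) + 1)))) → 0 < b' → b' ≤ b →
      ∀ β : ℝ, |β| ≤ b' → ∀ ε : ℝ, 0 < ε → ∃ τ₀ : ℝ, 0 < τ₀ ∧ ∀ τ : ℝ, τ₀ ≤ τ →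
        ∃ N₀ : ℕ, ∀ N : ℕ, N₀ ≤ N →
          ∫⁻ z, ENNReal.ofReal (Real.exp (β * ∑ i : Fin (N + 1),
              (τ * ((N : ℝ) + 1) ^ (-(1 / 3 : ℝ)))⁻¹ *
                ∫ r in (0 : ℝ)..(τ * ((N : ℝ) + 1) ^ (-(1 / 3 : ℝ))), f (((Φ N).flow r z) i) * (1 + ‖(((Φ N).flow r z) i).2‖ ^ 2)))
            ∂(localGibbsLaw σ (fun _ => a₀) (fun _ => u₀) (fun _ => θ₀) N (Φ N)) ≤
            ENNReal.ofReal (Real.exp (ε * ((N : ℝ) + 1))) :=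
    fun b b' f h _ hbb' β hβ => h β (hβ.trans hbb')
  have hclosure : ∀ b : ℝ, 0 < b → ∀ f ∈ {f : T3 × V3 →ᵇ ℝ |
      (∀ x, ∫ v, f (x, v) * (1 + ‖v‖ ^ 2) * localMaxwellian 1 θ₀ u₀ v = 0) ∧
      (∀ x (j : Fin 3), ∫ v, f (x, v) * (1 + ‖v‖ ^ 2) * v j * localMaxwellian 1 θ₀ u₀ v = 0) ∧
      (∀ x, ∫ v, f (x, v) * (1 + ‖v‖ ^ 2) * ‖v‖ ^ 2 * localMaxwellian 1 θ₀ u₀ v = 0)},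
      (∀ δ : ℝ, 0 < δ → ∃ g ∈ {f : T3 × V3 →ᵇ ℝ |
      (∀ x, ∫ v, f (x, v) * (1 + ‖v‖ ^ 2) * localMaxwellian 1 θ₀ u₀ v = 0) ∧
      (∀ x (j : Fin 3), ∫ v, f (x, v) * (1 + ‖v‖ ^ 2) * v j * localMaxwellian 1 θ₀ u₀ v = 0) ∧
      (∀ x, ∫ v, f (x, v) * (1 + ‖v‖ ^ 2) * ‖v‖ ^ 2 * localMaxwellian 1 θ₀ u₀ v = 0)}, ‖g - f‖ < δ ∧
      ∀ β : ℝ, |β| ≤ b → ∀ ε : ℝ, 0 < ε → ∃ τ₀ : ℝ, 0 < τ₀ ∧ ∀ τ : ℝ, τ₀ ≤ τ →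
        ∃ N₀ : ℕ, ∀ N : ℕ, N₀ ≤ N →
          ∫⁻ z, ENNReal.ofReal (Real.exp (β * ∑ i : Fin (N + 1),
              (τ * ((N : ℝ) + 1) ^ (-(1 / 3 : ℝ)))⁻¹ *
                ∫ r in (0 : ℝ)..(τ * ((N : ℝ) + 1) ^ (-(1 / 3 : ℝ))), g (((Φ N).flow r z) i) * (1 + ‖(((Φ N).flow r z) i).2‖ ^ 2)))
            ∂(localGibbsLaw σ (fun _ => a₀) (fun _ => u₀) (fun _ => θ₀) N (Φ N)) ≤
            ENNReal.ofReal (Real.exp (ε * ((N : ℝ) + 1)))) →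
      ∀ β : ℝ, |β| ≤ b / 2 → ∀ ε : ℝ, 0 < ε → ∃ τ₀ : ℝ, 0 < τ₀ ∧ ∀ τ : ℝ, τ₀ ≤ τ →
        ∃ N₀ : ℕ, ∀ N : ℕ, N₀ ≤ N →
          ∫⁻ z, ENNReal.ofReal (Real.exp (β * ∑ i : Fin (N + 1),
              (τ * ((N : ℝ) + 1) ^ (-(1 / 3 : ℝ)))⁻¹ *
                ∫ r in (0 : ℝ)..(τ * ((N : ℝ) + 1) ^ (-(1 / 3 : ℝ))), f (((Φ N).flow r z) i) * (1 + ‖(((Φ N).flow r z) i).2‖ ^ 2)))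
            ∂(localGibbsLaw σ (fun _ => a₀) (fun _ => u₀) (fun _ => θ₀) N (Φ N)) ≤
            ENNReal.ofReal (Real.exp (ε * ((N : ℝ) + 1))) := by
    intro b hb f hf happ
    obtain ⟨hf0, -, -⟩ := hf
    refine windowGood_of_approx ha hθ u₀ hσ2 Φ hb hf0 fun δ hδ => ?_
    obtain ⟨g, ⟨hg0, -, -⟩, hgf, hgood⟩ := happ δ hδ
    exact ⟨g, hg0, hgf, hgood⟩
  have hsum : ∀ b : ℝ, 0 < b → ∀ f g : T3 × V3 →ᵇ ℝ,
      (∀ β : ℝ, |β| ≤ b → ∀ ε : ℝ, 0 < ε → ∃ τ₀ : ℝ, 0 < τ₀ ∧ ∀ τ : ℝ, τ₀ ≤ τ →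
        ∃ N₀ : ℕ, ∀ N : ℕ, N₀ ≤ N →
          ∫⁻ z, ENNReal.ofReal (Real.exp (β * ∑ i : Fin (N + 1),
              (τ * ((N : ℝ) + 1) ^ (-(1 / 3 : ℝ)))⁻¹ *
                ∫ r in (0 : ℝ)..(τ * ((N : ℝ) + 1) ^ (-(1 / 3 : ℝ))), f (((Φ N).flow r z) i) * (1 + ‖(((Φ N).flow r z) i).2‖ ^ 2)))
            ∂(localGibbsLaw σ (fun _ => a₀) (fun _ => u₀) (fun _ => θ₀) N (Φ N)) ≤
            ENNReal.ofReal (Real.exp (ε * ((N : ℝ) + 1)))) →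
      (∀ β : ℝ, |β| ≤ b → ∀ ε : ℝ, 0 < ε → ∃ τ₀ : ℝ, 0 < τ₀ ∧ ∀ τ : ℝ, τ₀ ≤ τ →
        ∃ N₀ : ℕ, ∀ N : ℕ, N₀ ≤ N →
          ∫⁻ z, ENNReal.ofReal (Real.exp (β * ∑ i : Fin (N + 1),
              (τ * ((N : ℝ) + 1) ^ (-(1 / 3 : ℝ)))⁻¹ *
                ∫ r in (0 : ℝ)..(τ * ((N : ℝ) + 1) ^ (-(1 / 3 : ℝ))), g (((Φ N).flow r z) i) * (1 + ‖(((Φ N).flow r z) i).2‖ ^ 2)))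
            ∂(localGibbsLaw σ (fun _ => a₀) (fun _ => u₀) (fun _ => θ₀) N (Φ N)) ≤
            ENNReal.ofReal (Real.exp (ε * ((N : ℝ) + 1)))) →
      ∀ β : ℝ, |β| ≤ b / 2 → ∀ ε : ℝ, 0 < ε → ∃ τ₀ : ℝ, 0 < τ₀ ∧ ∀ τ : ℝ, τ₀ ≤ τ →
        ∃ N₀ : ℕ, ∀ N : ℕ, N₀ ≤ N →
          ∫⁻ z, ENNReal.ofReal (Real.exp (β * ∑ i : Fin (N + 1),
              (τ * ((N : ℝ) + 1) ^ (-(1 / 3 : ℝ)))⁻¹ *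
                ∫ r in (0 : ℝ)..(τ * ((N : ℝ) + 1) ^ (-(1 / 3 : ℝ))), (f + g) (((Φ N).flow r z) i) * (1 + ‖(((Φ N).flow r z) i).2‖ ^ 2)))
            ∂(localGibbsLaw σ (fun _ => a₀) (fun _ => u₀) (fun _ => θ₀) N (Φ N)) ≤
            ENNReal.ofReal (Real.exp (ε * ((N : ℝ) + 1))) := by
    intro b _ f g hf hg
    have e : ∀ y : T3 × V3, (f + g) y * (1 + ‖y.2‖ ^ 2) =
        f y * (1 + ‖y.2‖ ^ 2) + g y * (1 + ‖y.2‖ ^ 2) := fun y => by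
      rw [BoundedContinuousFunction.add_apply, add_mul]
    simp_rw [e]
    exact windowGood_add σ a₀ θ₀ u₀ Φ (F := fun y : T3 × V3 => f y * (1 + ‖y.2‖ ^ 2))
      (G := fun y : T3 × V3 => g y * (1 + ‖y.2‖ ^ 2)) (continuous_mul_quadWeight f)
      (continuous_mul_quadWeight g) hf hg
  have hneg : ∀ (b : ℝ) (f : T3 × V3 →ᵇ ℝ),
      (∀ β : ℝ, |β| ≤ b → ∀ ε : ℝ, 0 < ε → ∃ τ₀ : ℝ, 0 < τ₀ ∧ ∀ τ : ℝ, τ₀ ≤ τ →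
        ∃ N₀ : ℕ, ∀ N : ℕ, N₀ ≤ N →
          ∫⁻ z, ENNReal.ofReal (Real.exp (β * ∑ i : Fin (N + 1),
              (τ * ((N : ℝ) + 1) ^ (-(1 / 3 : ℝ)))⁻¹ *
                ∫ r in (0 : ℝ)..(τ * ((N : ℝ) + 1) ^ (-(1 / 3 : ℝ))), f (((Φ N).flow r z) i) * (1 + ‖(((Φ N).flow r z) i).2‖ ^ 2)))
            ∂(localGibbsLaw σ (fun _ => a₀) (fun _ => u₀) (fun _ => θ₀) N (Φ N)) ≤
            ENNReal.ofReal (Real.exp (ε * ((N : ℝ) + 1)))) →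
      ∀ β : ℝ, |β| ≤ b → ∀ ε : ℝ, 0 < ε → ∃ τ₀ : ℝ, 0 < τ₀ ∧ ∀ τ : ℝ, τ₀ ≤ τ →
        ∃ N₀ : ℕ, ∀ N : ℕ, N₀ ≤ N →
          ∫⁻ z, ENNReal.ofReal (Real.exp (β * ∑ i : Fin (N + 1),
              (τ * ((N : ℝ) + 1) ^ (-(1 / 3 : ℝ)))⁻¹ *
                ∫ r in (0 : ℝ)..(τ * ((N : ℝ) + 1) ^ (-(1 / 3 : ℝ))), (-f) (((Φ N).flow r z) i) * (1 + ‖(((Φ N).flow r z) i).2‖ ^ 2)))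
            ∂(localGibbsLaw σ (fun _ => a₀) (fun _ => u₀) (fun _ => θ₀) N (Φ N)) ≤
            ENNReal.ofReal (Real.exp (ε * ((N : ℝ) + 1))) := by
    intro b f hf
    have e : ∀ y : T3 × V3, (-f) y * (1 + ‖y.2‖ ^ 2) = -(f y * (1 + ‖y.2‖ ^ 2)) := fun y => by
      rw [BoundedContinuousFunction.neg_apply, neg_mul]
    simp_rw [e]
    exact windowGood_neg σ a₀ θ₀ u₀ Φ (F := fun y : T3 × V3 => f y * (1 + ‖y.2‖ ^ 2)) hf
  have hsmul : ∀ (b c : ℝ) (f : T3 × V3 →ᵇ ℝ), 0 < c →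
      (∀ β : ℝ, |β| ≤ b → ∀ ε : ℝ, 0 < ε → ∃ τ₀ : ℝ, 0 < τ₀ ∧ ∀ τ : ℝ, τ₀ ≤ τ →
        ∃ N₀ : ℕ, ∀ N : ℕ, N₀ ≤ N →
          ∫⁻ z, ENNReal.ofReal (Real.exp (β * ∑ i : Fin (N + 1),
              (τ * ((N : ℝ) + 1) ^ (-(1 / 3 : ℝ)))⁻¹ *
                ∫ r in (0 : ℝ)..(τ * ((N : ℝ) + 1) ^ (-(1 / 3 : ℝ))), f (((Φ N).flow r z) i) * (1 + ‖(((Φ N).flow r z) i).2‖ ^ 2)))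
            ∂(localGibbsLaw σ (fun _ => a₀) (fun _ => u₀) (fun _ => θ₀) N (Φ N)) ≤
            ENNReal.ofReal (Real.exp (ε * ((N : ℝ) + 1)))) →
      ∀ β : ℝ, |β| ≤ b / c → ∀ ε : ℝ, 0 < ε → ∃ τ₀ : ℝ, 0 < τ₀ ∧ ∀ τ : ℝ, τ₀ ≤ τ →
        ∃ N₀ : ℕ, ∀ N : ℕ, N₀ ≤ N →
          ∫⁻ z, ENNReal.ofReal (Real.exp (β * ∑ i : Fin (N + 1),
              (τ * ((N : ℝ) + 1) ^ (-(1 / 3 : ℝ)))⁻¹ *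
                ∫ r in (0 : ℝ)..(τ * ((N : ℝ) + 1) ^ (-(1 / 3 : ℝ))), (c • f) (((Φ N).flow r z) i) * (1 + ‖(((Φ N).flow r z) i).2‖ ^ 2)))
            ∂(localGibbsLaw σ (fun _ => a₀) (fun _ => u₀) (fun _ => θ₀) N (Φ N)) ≤
            ENNReal.ofReal (Real.exp (ε * ((N : ℝ) + 1))) := by
    intro b c f hc hf
    have e : ∀ y : T3 × V3, (c • f) y * (1 + ‖y.2‖ ^ 2) = c * (f y * (1 + ‖y.2‖ ^ 2)) :=
      fun y => by rw [BoundedContinuousFunction.smul_apply, smul_eq_mul, mul_assoc]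
    simp_rw [e]
    exact windowGood_const_mul σ a₀ θ₀ u₀ Φ (F := fun y : T3 × V3 => f y * (1 + ‖y.2‖ ^ 2)) hc hf
  obtain ⟨b, hb, hball⟩ := exists_uniform_range_of_baire (isClosed_fastClass hθ u₀)
    (zero_mem_fastClass θ₀ u₀) (add_mem_fastClass hθ u₀) (neg_mem_fastClass θ₀ u₀)
    (fun c f hf => smul_mem_fastClass θ₀ u₀ c f hf)
    (fun b f => ∀ β : ℝ, |β| ≤ b → ∀ ε : ℝ, 0 < ε → ∃ τ₀ : ℝ, 0 < τ₀ ∧ ∀ τ : ℝ, τ₀ ≤ τ →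
        ∃ N₀ : ℕ, ∀ N : ℕ, N₀ ≤ N →
          ∫⁻ z, ENNReal.ofReal (Real.exp (β * ∑ i : Fin (N + 1),
              (τ * ((N : ℝ) + 1) ^ (-(1 / 3 : ℝ)))⁻¹ *
                ∫ r in (0 : ℝ)..(τ * ((N : ℝ) + 1) ^ (-(1 / 3 : ℝ))), f (((Φ N).flow r z) i) * (1 + ‖(((Φ N).flow r z) i).2‖ ^ 2)))
            ∂(localGibbsLaw σ (fun _ => a₀) (fun _ => u₀) (fun _ => θ₀) N (Φ N)) ≤
            ENNReal.ofReal (Real.exp (ε * ((N : ℝ) + 1))))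
    hcover hanti hclosure hsum hneg hsmul C' hC'
  refine ⟨b, hb, ?_⟩
  intro G hG hGC hG0 hG1 hG2 β hβ ε hε
  -- decode `G = f ω`, `‖f‖ ≤ C'`, `f` in the class
  obtain ⟨f, hfC, hfG⟩ := exists_boundedContinuous_mul_quadWeight_eq hG hC' hGC
  have hf0 : ∀ x, ∫ v, f (x, v) * (1 + ‖v‖ ^ 2) * localMaxwellian 1 θ₀ u₀ v = 0 := fun x => by
    have e : ∀ v : V3, f (x, v) * (1 + ‖v‖ ^ 2) = G (x, v) := fun v => hfG (x, v)
    simp_rw [e]; exact hG0 x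
  have hf1 : ∀ x (j : Fin 3),
      ∫ v, f (x, v) * (1 + ‖v‖ ^ 2) * v j * localMaxwellian 1 θ₀ u₀ v = 0 := fun x j => by
    have e : ∀ v : V3, f (x, v) * (1 + ‖v‖ ^ 2) = G (x, v) := fun v => hfG (x, v)
    simp_rw [e]; exact hG1 x j
  have hf2 : ∀ x, ∫ v, f (x, v) * (1 + ‖v‖ ^ 2) * ‖v‖ ^ 2 * localMaxwellian 1 θ₀ u₀ v = 0 :=
    fun x => by
    have e : ∀ v : V3, f (x, v) * (1 + ‖v‖ ^ 2) = G (x, v) := fun v => hfG (x, v)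
    simp_rw [e]; exact hG2 x
  obtain ⟨τ₀, hτ₀, H⟩ := hball f ⟨hf0, hf1, hf2⟩ hfC β hβ ε hε
  refine ⟨τ₀, hτ₀, fun τ hτ => ?_⟩
  obtain ⟨N₀, hN⟩ := H τ hτ
  refine ⟨N₀, fun N hNN => ?_⟩
  have h := hN N hNN
  simp_rw [hfG] at h
  exact h

/-- **Registered helper stub `stub_uniformWindowLD`** (same term as `uniformWindowLD_of_equilibriumFastWindowLD`). [folklore] -/
theorem stub_uniformWindowLD : UniformWindowLDOfEquilibriumFastWindowLD :=
  uniformWindowLD_of_equilibriumFastWindowLD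

end Summit.AtomisticToContinuum.HydrodynamicLimit.Theorems.KineticWindowGronwallRareBandDock

end
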